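import Summits.BirchSwinnertonDyer.BirchSwinnertonDyer.Theorems.EisensteinPrimesLambdaFromCharacters
import Summits.BirchSwinnertonDyer.BirchSwinnertonDyer.Theorems.EisensteinPrimesMazurMCOnCellBTwistbackOnePartnerCertificates
import Summits.BirchSwinnertonDyer.Rank1Residual.X2.IsogenyQuotientLine
import Literature.NumberTheory.EllipticCurves.Wuthrich2014.ShaBoundProofs
import Literature.NumberTheory.EllipticCurves.ComplexMultiplicationLFunctionIsogenyHoldsProofs
import Literature.NumberTheory.EllipticCurves.AnalyticRankOrderProofs
import HarnessLib

/-!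
# Crux 3 `MazurMCOnCellB` (stmt-BirchSwinnertonDyer-19033), line `twistback` v4 — KERNEL F1, part C (the DOOR):
# the partner's UPPER half and Mazur's MC at a non-split X2b pair from a «KL-FLAT PARTNER» — ONE admissible `K`
# with `r_an(E^K) = 1` whose twist (or a curve `p`-isogenous to it) carries a ramified-even line with KL-flat
# characters and local balance `1`; NO `p`-adic `L`-function of any curve is evaluated

LEAD bsd-line-x2-p1 g10 (2026-08-28). HONEST FRAMING (cell `bsd-eis`, run/shared/lean/pub/bsd-eis/): conditional
theorems only; inputs BY NAME = the route's `PublishedInputs` (stmt-…-19037: Cassels, GZK, Wuthrich Thm. 16,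
Stein–Wuthrich, modularity, …), Disegni 2020 Thm. 4(1) (PUB), Greenberg–Vatsal Thm. (3.11)+(28)
(`thm311_hasUnitContent_iff_and_order_eq_of_lineRamifiedEven`, PUB, F1), and PER PAIR the KL-flat datum + STEP L;
nothing booked; no main conjecture / BSD proved for any curve unconditionally; 0 cells / labels / tiers move.

WHY (LEAD g9 verdict §4/§4′, `Cruxes/MazurMCOnCellB/Lines/twistback-lambda-formula-validation-g9.md`, 51/51 cells):
stub 6 of twistback v4 (∃-PARTNER) asks, per X2b pair `(W, p)`, for ONE admissible `K` with the Euler-system upper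
half at the rank-one twist `E^{(d_K)}` — an X2c ∩ `GVPar` pair, NON-split at `p` when `W` is (`p` splits in `K`).
p640749 §3(ii) delivers that upper half from the two-engine certificate `(μ_an, λ_an)(E^K) = (0, 1)`; part B
(`…LambdaFromCharacters`) now PRODUCES this certificate from character data: KL-flat (`p ∤` ONE generalized
Bernoulli number — for the quadratic characters at `p = 3`: `3 ∤ (1 − χ(3))·h(ℚ(√(D·d_K)))`) + the local balance
`1 + Σ_ℓ δ_E^{(ℓ)} = Σ_ℓ s_ℓ([φ(ℓ) ≡ ℓ] + [ψ(ℓ) ≡ ℓ])` (`= «c(E) = 1»`, `K`-independent on the census). Which member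
of the twist's isogeny class carries the RAMIFIED-EVEN line depends on the given `W` (its line is unramified-even or
ramified-odd; the twist's is unramified-odd or ramified-even), so the datum is taken on ANY globally minimal `V′`
`ℚ`-isogenous to the twist and moved back by Cassels' invariance of `BSD(E,p)` (GV's own reduction "`E′ = E/Φ`",
p. 28; tree `X2/IsogenyQuotientLine`, `Wuthrich2014.bsdp_of_isIsogenous`).

* §1 `missingUpperBoundAt_of_cellC_of_not_split_of_klFlat_isogenous` — PER PARTNER: X2c pair `(V, ℓ)` NON-split,
  `V′` isogenous to `V` with a KL-flat ramified-even line datum of balance `1` ⟹ `BSD(V, ℓ)` and its upper half.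
* §2 `mazurMainConjectureAt_of_cellB_of_not_split_of_indexLowerBoundAt_of_klFlat_twist` — PER PAIR, NON-split X2b:
  Mazur's MC at `(W, p)` ⟸ STEP L at ONE Heegner datum (`p ∤ c`) + ONE admissible `K` with `r_an = 1` at the twist
  + a KL-flat carrier isogenous to the twist (p642512 §5 with its `(0,1)` input DISCHARGED by part B).
* §3 `upperPartner_at_of_klFlat_partner` — the `(W, p)`-instance of stub 6's conclusion (VERBATIM shape) from ONE
  admissible `K` with `r_an(E^{(d_K)}) = 1` and a KL-flat carrier for every minimal model of the twist.

What remains OPEN for stub 6 on this road (honest): the EXISTENCE, per X2b pair, of such a `K` — a statement about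
class numbers of quadratic fields and analytic ranks in the quadratic-twist family (Kriz–Li 2019 §4 prove a positive
proportion of such `K` for their families at `p = 3`, to be typed), on the sub-row of local balance `1`; split pairs
and balance `≠ 1` rows are not served by this door.

References: [GreenbergVatsal2000] §2 p. 28, §3 Thm. (3.11), (26)–(28); [Wuthrich2014] Thm. 16; [Disegni2020] Thm. 4
(§3.2); [SteinWuthrich2013] Thm. 6.1; [MilneADT2006] Thm. I.7.3; [JetchevSkinnerWan2017] §7.4.1; [KrizLi2019] §4.
-/

set_option autoImplicit false

-- `Summit.BirchSwinnertonDyer.BirchSwinnertonDyer.…`: the summit and its single sub-problem share a name.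
set_option linter.dupNamespace false

noncomputable section

open scoped Classical MatrixGroups ModularForm

open CongruenceSubgroup WeierstrassCurve NumberField IsDedekindDomain Field PowerSeries
  Literature.NumberTheory.EllipticCurves
  Literature.NumberTheory.GaloisRepresentations
  Literature.NumberTheory.EllipticCurves.ModularForms
  Literature.NumberTheory.QuadraticFields
  Literature.NumberTheory.EllipticCurves.Rank1Residual
  Literature.NumberTheory.EllipticCurves.Rank1Residual.Typed
  Literature.NumberTheory.EllipticCurves.Wuthrich2014
  Literature.NumberTheory.EllipticCurves.SteinWuthrich2013
  Literature.NumberTheory.EllipticCurves.GreenbergVatsal2000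
  Literature.NumberTheory.EllipticCurves.Disegni2020
  Summit.BirchSwinnertonDyer.Rank1Residual
  Summit.BirchSwinnertonDyer.Rank1Residual.X2.IsogenyQuotientLine
  Summit.BirchSwinnertonDyer.BirchSwinnertonDyer.Theses
  Summit.BirchSwinnertonDyer.BirchSwinnertonDyer.Theorems.EisensteinPrimesMazurMCOnCellBTwistbackLowerHalf
  Summit.BirchSwinnertonDyer.BirchSwinnertonDyer.Theorems.EisensteinPrimesLambdaFromCharacters

namespace Summit.BirchSwinnertonDyer.BirchSwinnertonDyer.Theorems.EisensteinPrimesMazurMCOnCellBTwistbackKLFlatPartner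

/-! ## §1. PER PARTNER: the upper half at a NON-split X2c pair from a KL-flat carrier isogenous to it -/

/-- **PER PARTNER, NON-SPLIT: `BSD(V, ℓ)` and its upper half from a KL-flat ramified-even line datum on an isogenous
curve.** Data: `(V, ℓ)` an X2c pair (`ord_{s=1} L(V,s) = 1`, `ℓ ≠ 2` multiplicative, `V[ℓ]` reducible), `ℓ`
NON-split; `V′` globally minimal, `ℚ`-isogenous to `V` (possibly `V′ = V`), with a rational line `Φ₀ ≤ V′[ℓ]`
ramified at `ℓ` and even, presented by primitive characters `φ` (mod `m`, `ℓ ∣ m`) and `ψ` (mod `d`, `ℓ ∤ d`);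
`S₀ ∌ ℓ` ⊇ bad places of `V′` other than `ℓ`; KL-flat: `‖L_∅(C,0)‖ = ‖L_∅(D,0)‖ = 1`; local balance
`1 + Σ_{v∈S₀} δ_{V′}^{(v)} = Σ_{v∈S₀} s_v([φ(v) = v̄] + [ψ(v) = v̄])`. Then part B gives `(μ_an, λ_an)(V′, ℓ) = (0, 1)`,
b2b gen 19's `X2.bsdp_of_cellC_of_not_split_of_lamMin` gives `BSD(V′, ℓ)` (`V′` is X2c non-split: isogeny
invariance of the analytic rank, of multiplicative and of split type; reducible by its line), Cassels moves it to
`V`, and `Typed.missingPPartAt_of_bsdp` splits off the upper half. Inputs BY NAME: `PublishedInputs` (Cassels,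
GZK, modularity, Wuthrich, Stein–Wuthrich, GV), Disegni Thm. 4(1), GV Thm. (3.11) (`h311`).
[cite: GreenbergVatsal2000, §3 Thm. (3.11) (p. 43) with (26)–(28) and §2 p. 28 (E′ = E/Φ)]
[cite: Wuthrich2014, Thm. 16 (p. 397)] [cite: Disegni2020, Thm. 4 (§3.2)] [cite: SteinWuthrich2013, Thm. 6.1 (p. 20)]
[cite: MilneADT2006, Thm. I.7.3 and Remark I.7.4] -/
theorem missingUpperBoundAt_of_cellC_of_not_split_of_klFlat_isogenous (hP : EisensteinPrimes.PublishedInputs)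
    (hDis : padicBSD_rankOne_nonsplitMult) (h311 : thm311_hasUnitContent_iff_and_order_eq_of_lineRamifiedEven)
    (V : WeierstrassCurve ℚ) [V.IsElliptic] [V.IsGloballyMinimal] (ℓ : ℕ) [Fact ℓ.Prime]
    (hcV : X2.CellC V ℓ) (hns : ¬ V.HasSplitMultiplicativeReductionAtPrime ℓ)
    (V' : WeierstrassCurve ℚ) [V'.IsElliptic] [V'.IsGloballyMinimal] (hiso : IsIsogenous V V')
    (S₀ : Finset (HeightOneSpectrum (𝓞 ℚ))) (Φ₀ : AddSubgroup (V'.geomTorsion (ℓ : ℤ)))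
    (m : ℕ) [NeZero m] (φ : DirichletCharacter (ZMod ℓ) m)
    (d : ℕ) [NeZero d] (ψ : DirichletCharacter (ZMod ℓ) d)
    (hΦ : IsRationalLine V' ℓ Φ₀) (hram : ¬ LineUnramifiedAt V' ℓ Φ₀) (heven : LineEven V' ℓ Φ₀)
    (hφ : φ.IsPrimitive) (hψ : ψ.IsPrimitive) (hℓm : ℓ ∣ m) (hℓd : ¬ ℓ ∣ d)
    (hφ0 : ∀ (σ : absoluteGaloisGroup ℚ), ∀ P ∈ Φ₀,
      σ • P = (φ ((modNCyclotomicCharacter ℚ m σ : (ZMod m)ˣ) : ZMod m)).val • P)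
    (hψ0 : ∀ (σ : absoluteGaloisGroup ℚ) (P : V'.geomTorsion (ℓ : ℤ)),
      σ • P - (ψ ((modNCyclotomicCharacter ℚ d σ : (ZMod d)ˣ) : ZMod d)).val • P ∈ Φ₀)
    (hS₀p : ∀ v ∈ S₀, ((ℓ : ℕ) : 𝓞 ℚ) ∉ v.asIdeal)
    (hS : ∀ v : HeightOneSpectrum (𝓞 ℚ), v ∉ S₀ → ((ℓ : ℕ) : 𝓞 ℚ) ∉ v.asIdeal → V'.HasGoodReductionAt v)
    (hC1 : ‖characterLValueC ℓ φ ∅ 1‖ = 1) (hD1 : ‖characterLValueD ℓ ψ ∅ 1‖ = 1)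
    (hbal : 1 + ∑ v ∈ S₀, delta V' ℓ v =
      ∑ v ∈ S₀, ((if φ (Rat.HeightOneSpectrum.natGenerator v : ZMod m) =
            (Rat.HeightOneSpectrum.natGenerator v : ZMod ℓ)
          then sFactor ℓ (Rat.HeightOneSpectrum.natGenerator v) else 0) +
        (if ψ (Rat.HeightOneSpectrum.natGenerator v : ZMod d) =
            (Rat.HeightOneSpectrum.natGenerator v : ZMod ℓ)
          then sFactor ℓ (Rat.HeightOneSpectrum.natGenerator v) else 0))) :
    BSDp V ℓ ∧ MissingUpperBoundAt V ℓ := by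
  have hCassels := hP.2.1
  have hpar := hP.2.2.2.2.1
  have hnf := hP.2.2.2.2.2.1
  have hGZ := hP.2.2.2.2.2.2.2.1
  have hGZK := hP.2.2.2.2.2.2.2.2.2.2.1
  have hWu := hP.2.2.2.2.2.2.2.2.2.2.2.2.2.2.1
  have hJs := hP.2.2.2.2.2.2.2.2.2.2.2.2.2.2.2.1
  have hJn := hP.2.2.2.2.2.2.2.2.2.2.2.2.2.2.2.2.1
  have hHs := hP.2.2.2.2.2.2.2.2.2.2.2.2.2.2.2.2.2.1
  have hHn := hP.2.2.2.2.2.2.2.2.2.2.2.2.2.2.2.2.2.2.1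
  have hE : WeierstrassCurve.hasEntireLFunction_rat :=
    WeierstrassCurve.hasEntireLFunction_rat_of_exists_isNewformOf hnf
  have hp2 : ℓ ≠ 2 := hcV.2.1
  have hmult : V.HasMultiplicativeReductionAtPrime ℓ := hcV.2.2.2
  -- the carrier `V'` is an X2c pair, NON-split at `ℓ`
  have hmult' : V'.HasMultiplicativeReductionAtPrime ℓ := hasMultiplicativeReductionAtPrime_of_isIsogenous hiso hmult
  have hns' : ¬ V'.HasSplitMultiplicativeReductionAtPrime ℓ := fun hs ↦
    hns ((hasSplitMultiplicativeReductionAtPrime_iff_of_isIsogenous (p := ℓ) hiso).mpr hs)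
  have hr' : V'.analyticRank = 1 := by rw [← analyticRank_eq_of_isIsogenous' hiso, hcV.1]
  have hred' : ¬ V'.HasIrreducibleModPGaloisRep ℓ := not_hasIrreducibleModPGaloisRep_of_isRationalLine hΦ
  have hcV' : X2.CellC V' ℓ := ⟨hr', hp2, hred', hmult'⟩
  -- part B: the two-engine certificate `(μ_an, λ_an)(V', ℓ) = (0, 1)` from the KL-flat character data
  obtain ⟨hμ, hlam⟩ := analyticMuLE_zero_and_analyticLambdaEq_of_lineRamifiedEven_of_klFlat V' ℓ h311 hWu S₀ Φ₀
    m φ d ψ hp2 hmult' hΦ hram heven hφ hψ hℓm hℓd hφ0 hψ0 hS₀p hS hC1 hD1 1 hbal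
  -- `BSD(V', ℓ)` by λ-minimality, then Cassels
  have hB' : BSDp V' ℓ :=
    X2.bsdp_of_cellC_of_not_split_of_lamMin V' ℓ hDis hWu hJs hJn hHs hHn hGZ hGZK hpar hcV' hns' hμ hlam
  obtain ⟨-, hfin'⟩ := hGZK V' (by rw [hr'])
  have hlead' : V'.leadingLCoeff ≠ 0 := V'.leadingLCoeff_ne_zero_holds (hE V')
  have hB : BSDp V ℓ := bsdp_of_isIsogenous hCassels hiso hfin' hlead' hB'
  haveI : Finite V.sha := (hGZK V (le_of_eq hcV.1)).2
  exact ⟨hB, (lower_and_upper_of_missingPPartAt V ℓ (missingPPartAt_of_bsdp V ℓ hB)).2⟩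

/-! ## §2. PER PAIR, NON-SPLIT X2b: Mazur's MC from STEP L at ONE Heegner datum and a KL-flat partner -/

/-- **PER PAIR, NON-SPLIT: Mazur's main conjecture at an X2b pair from STEP L over `K` (rank-zero orientation) at ONE
Heegner datum with `p ∤ c`, and ONE admissible `K` whose rank-one twist has a KL-FLAT CARRIER** (a globally minimal
`V′` `ℚ`-isogenous to the twist `Wd` with a ramified-even line, primitive characters `φ`, `ψ`, `‖L_∅(C,0)‖ =
‖L_∅(D,0)‖ = 1` and local balance `1`). p642512 §5 VERBATIM with its per-pair two-engine input `(μ_an, λ_an)(E^K) =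
(0,1)` DISCHARGED by part B + §1 (the twist keeps the non-split type because `p` splits in `K`). Inputs by name:
`PublishedInputs`, Disegni 2020 Thm. 4(1), GV Thm. (3.11); per pair: STEP L (`hlow`; = item -27489 at this datum,
a theorem modulo Keller–Yin Thm. D) and the KL-flat carrier. BSD / MC proved for no curve unconditionally.
[cite: JetchevSkinnerWan2017, §7.4.1 (eq:shalowerK-1)] [cite: GreenbergVatsal2000, §3 Thm. (3.11) (p. 43) and §2 p. 28]
[cite: Disegni2020, Thm. 4 (§3.2)] [cite: SteinWuthrich2013, Thm. 6.1 (p. 20), §4.2] [cite: Wuthrich2014, Thm. 16 (p. 397)] -/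
theorem mazurMainConjectureAt_of_cellB_of_not_split_of_indexLowerBoundAt_of_klFlat_twist
    (hP : EisensteinPrimes.PublishedInputs) (hDis : padicBSD_rankOne_nonsplitMult)
    (h311 : thm311_hasUnitContent_iff_and_order_eq_of_lineRamifiedEven)
    (W : WeierstrassCurve ℚ) [W.IsElliptic] [W.IsGloballyMinimal] (p : ℕ) [Fact p.Prime]
    (hc : X2.CellB W p) (hns : ¬ W.HasSplitMultiplicativeReductionAtPrime p)
    (N : ℕ) [NeZero N] (K : Type) [Field K] [NumberField K]
    (Dt : ModularParametrizationData W N) (H : HeegnerDatum N (NumberField.discr K)) (ι : K →+* ℂ)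
    (P : (W.baseChange K).toAffine.Point)
    (hK : IsImaginaryQuadratic K) (hodd : Odd (NumberField.discr K)) (hlt : NumberField.discr K < -4)
    (hN : W.conductorNorm ℤ = N) (hHN : SatisfiesHeegnerHypothesis N K)
    (hHp : SatisfiesHeegnerHypothesis p K)
    (hPt : WeierstrassCurve.Affine.Point.map ι.toRatAlgHom P = heegnerPointComplex Dt H)
    (hcM : ¬ (p : ℤ) ∣ Dt.c)
    (Wd : WeierstrassCurve ℚ) [Wd.IsElliptic] [Wd.IsGloballyMinimal]
    (hWd : ∃ C : VariableChange ℚ, C • Wd = W.quadraticTwist (NumberField.discr K : ℚ))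
    (hrd : Wd.analyticRank = 1)
    (hlow : Finite (W.baseChange K).sha → X11b.IndexLowerBoundAt W p K P)
    (V' : WeierstrassCurve ℚ) [V'.IsElliptic] [V'.IsGloballyMinimal] (hiso : IsIsogenous Wd V')
    (S₀ : Finset (HeightOneSpectrum (𝓞 ℚ))) (Φ₀ : AddSubgroup (V'.geomTorsion (p : ℤ)))
    (m : ℕ) [NeZero m] (φ : DirichletCharacter (ZMod p) m)
    (d : ℕ) [NeZero d] (ψ : DirichletCharacter (ZMod p) d)
    (hΦ : IsRationalLine V' p Φ₀) (hram : ¬ LineUnramifiedAt V' p Φ₀) (heven : LineEven V' p Φ₀)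
    (hφ : φ.IsPrimitive) (hψ : ψ.IsPrimitive) (hpm : p ∣ m) (hpd : ¬ p ∣ d)
    (hφ0 : ∀ (σ : absoluteGaloisGroup ℚ), ∀ Q ∈ Φ₀,
      σ • Q = (φ ((modNCyclotomicCharacter ℚ m σ : (ZMod m)ˣ) : ZMod m)).val • Q)
    (hψ0 : ∀ (σ : absoluteGaloisGroup ℚ) (Q : V'.geomTorsion (p : ℤ)),
      σ • Q - (ψ ((modNCyclotomicCharacter ℚ d σ : (ZMod d)ˣ) : ZMod d)).val • Q ∈ Φ₀)
    (hS₀p : ∀ v ∈ S₀, ((p : ℕ) : 𝓞 ℚ) ∉ v.asIdeal)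
    (hS : ∀ v : HeightOneSpectrum (𝓞 ℚ), v ∉ S₀ → ((p : ℕ) : 𝓞 ℚ) ∉ v.asIdeal → V'.HasGoodReductionAt v)
    (hC1 : ‖characterLValueC p φ ∅ 1‖ = 1) (hD1 : ‖characterLValueD p ψ ∅ 1‖ = 1)
    (hbal : 1 + ∑ v ∈ S₀, delta V' p v =
      ∑ v ∈ S₀, ((if φ (Rat.HeightOneSpectrum.natGenerator v : ZMod m) =
            (Rat.HeightOneSpectrum.natGenerator v : ZMod p)
          then sFactor p (Rat.HeightOneSpectrum.natGenerator v) else 0) +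
        (if ψ (Rat.HeightOneSpectrum.natGenerator v : ZMod d) =
            (Rat.HeightOneSpectrum.natGenerator v : ZMod p)
          then sFactor p (Rat.HeightOneSpectrum.natGenerator v) else 0))) :
    X2.MazurMainConjectureAt W p := by
  have hnf := hP.2.2.2.2.2.1
  have hGZ := hP.2.2.2.2.2.2.2.2.1
  have hKo := hP.2.2.2.2.2.2.2.2.2.1
  have hGZK := hP.2.2.2.2.2.2.2.2.2.2.1
  have hWu := hP.2.2.2.2.2.2.2.2.2.2.2.2.2.2.1
  have hJs := hP.2.2.2.2.2.2.2.2.2.2.2.2.2.2.2.1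
  have hJn := hP.2.2.2.2.2.2.2.2.2.2.2.2.2.2.2.2.1
  have hHs := hP.2.2.2.2.2.2.2.2.2.2.2.2.2.2.2.2.2.1
  have hHn := hP.2.2.2.2.2.2.2.2.2.2.2.2.2.2.2.2.2.2.1
  have hGS := hP.2.2.2.2.2.2.2.2.2.2.2.2.2.2.2.2.2.2.2
  have hE : WeierstrassCurve.hasEntireLFunction_rat :=
    WeierstrassCurve.hasEntireLFunction_rat_of_exists_isNewformOf hnf
  have hpP : p.Prime := Fact.out
  have hp2 : p ≠ 2 := hc.2.1.1
  have hred : ¬ W.HasIrreducibleModPGaloisRep p := hc.2.1.2.1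
  have hmult : W.HasMultiplicativeReductionAtPrime p := hc.2.1.2.2
  have hr : W.analyticRank = 0 := hc.1
  obtain ⟨C, hC⟩ := hWd
  have hXd : ClassX2 Wd p := X2.classX2_twist W p hc.2.1 K hK hHp Wd ⟨C, hC⟩
  have hnsd : ¬ Wd.HasSplitMultiplicativeReductionAtPrime p := fun hs ↦
    hns ((X2.hasSplitMultiplicativeReductionAtPrime_iff_of_smul_eq_quadraticTwist W Wd hK p hp2 hmult hHp
      hC).mp hs)
  have hUd : MissingUpperBoundAt Wd p :=
    (missingUpperBoundAt_of_cellC_of_not_split_of_klFlat_isogenous hP hDis h311 Wd p ⟨hrd, hXd⟩ hnsd V'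
      hiso S₀ Φ₀ m φ d ψ hΦ hram heven hφ hψ hpm hpd hφ0 hψ0 hS₀p hS hC1 hD1 hbal).2
  exact mazurMainConjectureAt_of_indexLowerBoundAt_of_upper_twist hWu hJs hJn hHs hHn hGZK hE W p (hGS W p) N K
    Dt H ι P (hGZ _ W K) (hKo _ W K) hK hodd hlt hN hHN hHp hPt hcM hp2 hmult hred hr Wd ⟨C, hC⟩ hrd hlow hUd

/-! ## §3. The `(W, p)`-instance of stub 6 (∃-PARTNER) from ONE admissible `K` with a KL-flat carrier -/

/-- **Stub 6's conclusion AT ONE X2b pair (VERBATIM shape) from a KL-FLAT PARTNER**: for a NON-split X2b pair `(W, p)`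
and ONE admissible `K` (imaginary quadratic, Heegner for `N_W` and for `p`, `d_K` odd `< −4`,
`ord_{s=1} L(E^{(d_K)}, s) = 1`) such that every globally minimal model `Wd` of the twist has a KL-FLAT CARRIER
(`V′` isogenous to `Wd` with a ramified-even line, primitive characters, `‖L_∅(C,0)‖ = ‖L_∅(D,0)‖ = 1`, local
balance `1`): the partner clause of `stub_upperPartner` holds at `(W, p)` with this `K`. So on the sub-row of local
balance `1`, (∃-PARTNER) at `(W, p)` — hence Mazur's MC at `(W, p)` modulo STEP L (p640326 §1) — is reduced to ONE
class-number-type statement (`p ∤ (1 − χ(p))·B_{1,χ}` for the carrier's odd character) and ONE analytic rank in the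
quadratic-twist family; no `p`-adic `L`-function, height or Schneider hypothesis. The existence of such `K` is NOT
proved here (Kriz–Li 2019 §4 for their families at `p = 3`, to be typed). [cite: GreenbergVatsal2000, §3 Thm. (3.11) (p. 43) and §2 p. 28]
[cite: Disegni2020, Thm. 4 (§3.2)] [cite: Wuthrich2014, Thm. 16 (p. 397)] [cite: KrizLi2019, §4 (the supply of K; not used)] -/
theorem upperPartner_at_of_klFlat_partner (hP : EisensteinPrimes.PublishedInputs)
    (hDis : padicBSD_rankOne_nonsplitMult) (h311 : thm311_hasUnitContent_iff_and_order_eq_of_lineRamifiedEven)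
    (W : WeierstrassCurve ℚ) [W.IsElliptic] [W.IsGloballyMinimal] (p : ℕ) [Fact p.Prime]
    (hc : X2.CellB W p) (hns : ¬ W.HasSplitMultiplicativeReductionAtPrime p)
    (K : Type) [Field K] [NumberField K] (hK : IsImaginaryQuadratic K)
    (hHN : SatisfiesHeegnerHypothesis (W.conductorNorm ℤ) K) (hHp : SatisfiesHeegnerHypothesis p K)
    (hodd : Odd (NumberField.discr K)) (hlt : NumberField.discr K < -4)
    (hr1 : (W.quadraticTwist (NumberField.discr K : ℚ)).analyticRank = 1)
    (hKL : ∀ (Wd : WeierstrassCurve ℚ) [Wd.IsElliptic] [Wd.IsGloballyMinimal],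
      (∃ C : VariableChange ℚ, C • Wd = W.quadraticTwist (NumberField.discr K : ℚ)) →
      ∃ (V' : WeierstrassCurve ℚ) (_ : V'.IsElliptic) (_ : V'.IsGloballyMinimal), IsIsogenous Wd V' ∧
        ∃ (S₀ : Finset (HeightOneSpectrum (𝓞 ℚ))) (Φ₀ : AddSubgroup (V'.geomTorsion (p : ℤ)))
          (m : ℕ) (_ : NeZero m) (φ : DirichletCharacter (ZMod p) m)
          (d : ℕ) (_ : NeZero d) (ψ : DirichletCharacter (ZMod p) d),
          IsRationalLine V' p Φ₀ ∧ ¬ LineUnramifiedAt V' p Φ₀ ∧ LineEven V' p Φ₀ ∧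
          φ.IsPrimitive ∧ ψ.IsPrimitive ∧ p ∣ m ∧ ¬ p ∣ d ∧
          (∀ (σ : absoluteGaloisGroup ℚ), ∀ Q ∈ Φ₀,
            σ • Q = (φ ((modNCyclotomicCharacter ℚ m σ : (ZMod m)ˣ) : ZMod m)).val • Q) ∧
          (∀ (σ : absoluteGaloisGroup ℚ) (Q : V'.geomTorsion (p : ℤ)),
            σ • Q - (ψ ((modNCyclotomicCharacter ℚ d σ : (ZMod d)ˣ) : ZMod d)).val • Q ∈ Φ₀) ∧
          (∀ v ∈ S₀, ((p : ℕ) : 𝓞 ℚ) ∉ v.asIdeal) ∧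
          (∀ v : HeightOneSpectrum (𝓞 ℚ), v ∉ S₀ → ((p : ℕ) : 𝓞 ℚ) ∉ v.asIdeal →
            V'.HasGoodReductionAt v) ∧
          ‖characterLValueC p φ ∅ 1‖ = 1 ∧ ‖characterLValueD p ψ ∅ 1‖ = 1 ∧
          1 + ∑ v ∈ S₀, delta V' p v =
            ∑ v ∈ S₀, ((if φ (Rat.HeightOneSpectrum.natGenerator v : ZMod m) =
                  (Rat.HeightOneSpectrum.natGenerator v : ZMod p)
                then sFactor p (Rat.HeightOneSpectrum.natGenerator v) else 0) +
              (if ψ (Rat.HeightOneSpectrum.natGenerator v : ZMod d) =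
                  (Rat.HeightOneSpectrum.natGenerator v : ZMod p)
                then sFactor p (Rat.HeightOneSpectrum.natGenerator v) else 0))) :
    ∃ (K : Type) (_ : Field K) (_ : NumberField K), IsImaginaryQuadratic K ∧
      SatisfiesHeegnerHypothesis (W.conductorNorm ℤ) K ∧ SatisfiesHeegnerHypothesis p K ∧
      Odd (NumberField.discr K) ∧ NumberField.discr K < -4 ∧
      (W.quadraticTwist (NumberField.discr K : ℚ)).analyticRank = 1 ∧
      ∀ (Wd : WeierstrassCurve ℚ) [Wd.IsElliptic] [Wd.IsGloballyMinimal],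
        (∃ C : VariableChange ℚ, C • Wd = W.quadraticTwist (NumberField.discr K : ℚ)) →
        MissingUpperBoundAt Wd p := by
  have hp2 : p ≠ 2 := hc.2.1.1
  have hmult : W.HasMultiplicativeReductionAtPrime p := hc.2.1.2.2
  refine ⟨K, inferInstance, inferInstance, hK, hHN, hHp, hodd, hlt, hr1, fun Wd _ _ hWd ↦ ?_⟩
  obtain ⟨V', _, _, hiso, S₀, Φ₀, m, _, φ, d, _, ψ, hΦ, hram, heven, hφ, hψ, hpm, hpd, hφ0, hψ0, hS₀p, hS,
    hC1, hD1, hbal⟩ := hKL Wd hWd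
  obtain ⟨C, hC⟩ := hWd
  have hrd : Wd.analyticRank = 1 := by
    have h := congrArg WeierstrassCurve.analyticRank hC
    rw [analyticRank_smul] at h
    exact h.trans hr1
  have hXd : ClassX2 Wd p := X2.classX2_twist W p hc.2.1 K hK hHp Wd ⟨C, hC⟩
  have hnsd : ¬ Wd.HasSplitMultiplicativeReductionAtPrime p := fun hs ↦
    hns ((X2.hasSplitMultiplicativeReductionAtPrime_iff_of_smul_eq_quadraticTwist W Wd hK p hp2 hmult hHp
      hC).mp hs)
  exact (missingUpperBoundAt_of_cellC_of_not_split_of_klFlat_isogenous hP hDis h311 Wd p ⟨hrd, hXd⟩ hnsd V' hiso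
    S₀ Φ₀ m φ d ψ hΦ hram heven hφ hψ hpm hpd hφ0 hψ0 hS₀p hS hC1 hD1 hbal).2

end Summit.BirchSwinnertonDyer.BirchSwinnertonDyer.Theorems.EisensteinPrimesMazurMCOnCellBTwistbackKLFlatPartner

end
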